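import Summits.ResolutionOfSingularities.ResolutionOfSingularities.Theorems.MarkedTransferCampaignW31UscAssembly
import HarnessLib

/-!
# [OURS · L1 W3.1] The HILBERT-TYPE semicontinuity behind «u.s.c. of `Inv`» (slot W3.1, seat res-L1-s31-pv-3)

Cell `res-hironaka` (run/shared/lean/pub/res-hironaka/), rung L (rescue) of LADDER-RESOLUTION, slot W3.1 «u.s.c. first»
(positive rung, verdict-free). Companion of `Theorems/MarkedTransferCampaignW31UscAssembly.lean` (p467881, the assembly
`CampaignW31UscInvOneExponentI p` ⇐ the three pieces (i)–(iii) of `…EdgeHilbertLsc.lean` p464862). HOST (custody, no new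
route): the existing crux `Theses.MarkedTransfer.HypersurfaceOrderReduction` stmt-ResolutionOfSingularities-16155,
`--supports … --as helper`, as the companions.

HONEST FRAMING. Everything below is OURS (theorems about OUR typed carriers) or pure topology; NOTHING here is a
statement of H. Hironaka's manuscript *Resolution of singularities in positive characteristics* (2017-03-23,
[Hironaka2017], lit key `paper:url-3343fd9e678b`) and nothing here asserts that any statement of that manuscript holds.
AI-produced; weaker than expert review.

## Why this file (RESCUE-SEED §1 W3.1, barrier column `DirectrixSmallCharacteristic*`)

The slot statement reads `Inv_ξ(E) = (n, n − r, q_1, …, q_r)` off EDGE DATA (Def. 4.9), whose dictionary with the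
edge algebra (piece (ii), `CampaignW31EdgeHilbDictionary`) is where Diff-stability and the perfectness of residue fields
enter. The semicontinuity itself lives one level below, on the HILBERT FUNCTION `a ↦ dim_{κ(ξ)} G(ξ)_a` of the edge
algebra (`CampaignW31.edgeHilbAt`), and needs only pieces (i) `CampaignW31EdgeHilbLsc` and (iii)
`CampaignW31EdgeHilbFiniteRange`: near every closed singular point `ξ₀`, within `Sing(E)_cl`, the edge Hilbert function
DOMINATES the one at `ξ₀` in every degree (`campaignW31_edgeHilb_dominates_nearby`). This is the «Hilbert-type datum»
form of the slot statement — it makes sense, and is proved here from (i)+(iii), with no edge data, no directrix and no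
hypothesis on residue fields; the assembly p467881 is this statement composed with the dictionary (ii) and the tree's
combinatorial core `Datum.EdgeInv.key_le_of_hilb_le`.

## What is proved (sorry-free; axioms ⊆ {propext, Classical.choice, Quot.sound})

* `CampaignW31.eventually_forall_le_of_lowerSemicontinuousOn` — topology: coordinatewise lower semicontinuity on `S`
  of a family `H ξ : ι → β` (`β` linear) with finitely many occurring functions ⇒ near each `ξ₀ ∈ S` (within `S`),
  `H ξ ≥ H ξ₀` in EVERY coordinate at once.
* `campaignW31_edgeHilb_dominates_nearby` — (i) + (iii) ⇒ the Hilbert-type semicontinuity along `Sing(E)_cl`, for every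
  perfect `K` of characteristic `p`, ambient datum `A` and standard `E`.
* `campaignW31_selInv_image_finite` — (ii) + (iii) ⇒ only finitely many values `Inv_ξ(E)`, `ξ ∈ Sing(E)_cl`, occur
  (for every selection of Def. 4.9 edge data); complements p467881's Noetherian route to `CampaignW31InvmaxClosedI`.

## References (context only; nothing below is a premise)

* H. Hironaka, ms. 2017-03-23, Def. 4.6 p.19 l.33–37; Eq. (34) p.24; p.86 l.7–10. [Hironaka2017]
* V. Cossart, U. Jannsen, S. Saito, LNM 2270 (2020), Lemma 2.34 (pattern). [CossartJannsenSaito2020]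
-/

noncomputable section

set_option linter.dupNamespace false -- mandated namespace of this single-conjunct summit

open _root_.AlgebraicGeometry _root_.TopologicalSpace _root_.Topology _root_.Filter

namespace Summit.ResolutionOfSingularities.ResolutionOfSingularities.Theorems

open Literature.AlgebraicGeometry.Resolution
open Literature.AlgebraicGeometry.Hironaka2017
open Literature.AlgebraicGeometry.Hironaka2017.S02Preliminaries
open Literature.AlgebraicGeometry.Hironaka2017.S04CharAlgebra
open Literature.AlgebraicGeometry.Hironaka2017.Datum
open Literature.AlgebraicGeometry.Hironaka2017.EdgeHilbert

universe u

namespace CampaignW31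

/-- Topology: if each coordinate `ξ ↦ H ξ a` of a family of functions `H ξ : ι → β` (`β` linearly ordered) is lower
semicontinuous on `S`, and only finitely many functions `H ξ`, `ξ ∈ S`, occur, then near every `ξ₀ ∈ S` (within `S`)
the function `H ξ` dominates `H ξ₀` in EVERY coordinate simultaneously (each occurring function failing to dominate
fails in one coordinate, excluded near `ξ₀` by semicontinuity in that coordinate). [folklore] -/
theorem eventually_forall_le_of_lowerSemicontinuousOn {X : Type*} [TopologicalSpace X] {ι β : Type*}
    [LinearOrder β] (H : X → ι → β) (S : Set X)
    (hlsc : ∀ a, LowerSemicontinuousOn (fun ξ => H ξ a) S)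
    (hfin : (Set.range fun ξ : ↥S => H (ξ : X)).Finite) {ξ₀ : X} (h₀ : ξ₀ ∈ S) :
    ∀ᶠ ξ in 𝓝[S] ξ₀, ∀ a, H ξ₀ a ≤ H ξ a := by
  have key : ∀ g ∈ Set.range (fun ξ : ↥S => H (ξ : X)),
      ∀ᶠ ξ in 𝓝[S] ξ₀, H ξ = g → ∀ a, H ξ₀ a ≤ H ξ a := by
    intro g _
    by_cases hbad : ∃ a, g a < H ξ₀ a
    · obtain ⟨a, ha⟩ := hbad
      have hev : ∀ᶠ ξ in 𝓝[S] ξ₀, g a < H ξ a :=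
        (lowerSemicontinuousWithinAt_iff.1 (hlsc a ξ₀ h₀)) (g a) ha
      exact hev.mono fun ξ hξ hEq => absurd (hEq ▸ hξ) (lt_irrefl _)
    · push Not at hbad
      exact Filter.Eventually.of_forall fun ξ hEq a => hEq ▸ hbad a
  filter_upwards [(Filter.eventually_all_finite hfin).2 key, eventually_mem_nhdsWithin] with ξ hξ hmem
  exact hξ (H ξ) ⟨⟨ξ, hmem⟩, rfl⟩ rfl

end CampaignW31

open CampaignW31

/-- **[OURS · L1 W3.1] the HILBERT-TYPE semicontinuity along `Sing(E)_cl`** (replaces the role of p.86 l.7–10 in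
Hilbert-function form; NOT a statement of the manuscript): from (i) `CampaignW31EdgeHilbLsc p` and (iii)
`CampaignW31EdgeHilbFiniteRange p`, for every perfect `K` of characteristic `p`, ambient datum `A`, standard `E` and
closed singular point `ξ₀`: near `ξ₀` within `Sing(E)_cl`, `dim_{κ(ξ)} G(ξ)_a ≥ dim_{κ(ξ₀)} G(ξ₀)_a` for EVERY degree
`a`. No edge data, no directrix, no residue-field hypothesis. [folklore] -/
theorem campaignW31_edgeHilb_dominates_nearby (p : ℕ) [Fact p.Prime]
    (hlsc : CampaignW31EdgeHilbLsc.{u} p) (hfin : CampaignW31EdgeHilbFiniteRange.{u} p)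
    (K : Type u) [Field K] [CharP K p] [PerfectField K] (A : AmbientDatum p K) (E : IdealExponent A.Z)
    (hE : E.IsStandard) {ξ₀ : A.Z} (h₀ : ξ₀ ∈ E.sing ∩ S02Preliminaries.closedPoints A.Z) :
    ∀ᶠ ξ in 𝓝[E.sing ∩ S02Preliminaries.closedPoints A.Z] ξ₀, ∀ a, edgeHilbAt E ξ₀ a ≤ edgeHilbAt E ξ a :=
  eventually_forall_le_of_lowerSemicontinuousOn (fun ξ a => edgeHilbAt E ξ a) _
    (fun a => hlsc K A E hE a) (hfin K A E hE) h₀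

/-- **[OURS · L1 W3.1] finitely many values of `Inv` on `Sing(E)_cl`** (replaces nothing printed; NOT a statement of
the manuscript): under the dictionary (ii) `CampaignW31EdgeHilbDictionary p`, two Def. 4.9 edge data at closed singular
points with the same edge Hilbert function give the same `Inv` (p467881 `CampaignW31.inv_eq_of_hilb_eq`); with (iii)
`CampaignW31EdgeHilbFiniteRange p` the value set `{Inv_ξ(E) | ξ ∈ Sing(E)_cl}` read off any selection is finite.
[folklore] -/
theorem campaignW31_selInv_image_finite (p : ℕ) [Fact p.Prime]
    (hdict : CampaignW31EdgeHilbDictionary.{u} p) (hfin : CampaignW31EdgeHilbFiniteRange.{u} p)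
    (K : Type u) [Field K] [CharP K p] [PerfectField K] (A : AmbientDatum p K) (n : ℕ) (E : IdealExponent A.Z)
    (hE : E.IsStandard) (sel : EdgeDataSelection p n E CampaignW31.edgeDataProvenance) :
    (selInv sel '' (E.sing ∩ S02Preliminaries.closedPoints A.Z)).Finite := by
  classical
  let T : Set A.Z := E.sing ∩ S02Preliminaries.closedPoints A.Z
  let Hf : A.Z → ℕ → ℕ∞ := fun ξ a => edgeHilbAt E ξ a
  have hR : (Set.range fun ξ : ↥T => Hf (ξ : A.Z)).Finite := hfin K A E hE
  -- same Hilbert function ⇒ same `Inv`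
  have hdet : ∀ ξ (hξ : ξ ∈ T) η (hη : η ∈ T), Hf ξ = Hf η → selInv sel ξ = selInv sel η := by
    intro ξ hξ η hη hH
    have hq : ∀ a, hilb (EdgeDatum.q (sel.D η hη)) a = hilb (EdgeDatum.q (sel.D ξ hξ)) a := by
      intro a
      have e : edgeHilbAt E ξ a = edgeHilbAt E η a := congrFun hH a
      rw [hdict K A n E hE ξ hξ (sel.D ξ hξ) (sel.isEdgeData ξ hξ) a,
        hdict K A n E hE η hη (sel.D η hη) (sel.isEdgeData η hη) a] at e
      exact_mod_cast e.symm
    have h0 : selInv sel ξ = inv (sel.D ξ hξ) := by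
      unfold selInv
      rw [dif_pos hξ]
    have h1 : selInv sel η = inv (sel.D η hη) := by
      unfold selInv
      rw [dif_pos hη]
    rw [h0, h1]
    exact inv_eq_of_hilb_eq (sel.D η hη) (sel.D ξ hξ) hq
  -- one representative point per occurring Hilbert function
  let φ : (ℕ → ℕ∞) → EdgeInv n := fun g =>
    if h : ∃ ξ : ↥T, Hf (ξ : A.Z) = g then selInv sel (h.choose : A.Z)
    else ⟨[], Nat.zero_le n, fun _ h => nomatch h⟩
  refine (hR.image φ).subset ?_
  rintro _ ⟨ξ, hξ, rfl⟩
  have hex : ∃ η : ↥T, Hf (η : A.Z) = Hf ξ := ⟨⟨ξ, hξ⟩, rfl⟩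
  refine ⟨Hf ξ, ⟨⟨ξ, hξ⟩, rfl⟩, ?_⟩
  show φ (Hf ξ) = selInv sel ξ
  simp only [φ, dif_pos hex]
  exact hdet _ hex.choose.2 ξ hξ hex.choose_spec

end Summit.ResolutionOfSingularities.ResolutionOfSingularities.Theorems

end
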